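import Mathlib
import Summits.RiemannHypothesis.RiemannHypothesis.Theorems.HandoffVerifiedGramKernel
import HarnessLib

/-!
# THEOREM V with an abstract prime-term bound (handoff prove-1, ATTEMPT-17 §2)

THEOREM V (`HandoffVerifiedGramKernel.weilPositivityOn_of_rhUpTo_of_nearNullSamplingK`) reads the
HIGH part `G₂ = K - K ⋆ φ` (`K = g ⋆ g̃`) of a window test on the prime side through the bound
`‖prime(G₂)‖ ≤ 2 S(2a + δ) · M_φ(g)` (`norm_weilPrimeTerm_highPartK_le`), whence the margin condition
`log π + 2 S(2a + δ) + c ≤ Re ψ(1/4 + ih/2)`.  This file re-proves the high-part estimate, THEOREM V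
and the reduction with the prime-term bound an ABSTRACT constant `L` — a hypothesis
`‖prime(G₂)‖ ≤ L · M_φ(g)` — and the margin `log π + L + c ≤ Re ψ(1/4 + ih/2)`
(`weilFunctional_highPartK_re_ge_of_primeBound`, `weilQuadratic_re_ge_verifiedGramK_of_primeBound`,
`weilPositivityOn_of_rhUpTo_of_nearNullSamplingK_of_primeBound`); the tree's statements are the case
`L = 2 S(2a + δ)` (`norm_weilPrimeTerm_highPartK_le_two_primeSum`).  The point (ATTEMPT-16 §R,
ATTEMPT-17): for even-order flat kernels LEMMA P gives `L = S(2a + δ) + S(a + δ/2)` (tapered margin,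
`HandoffTaperedMargin`) and in general `L = Λ_P(a + δ/2)`, the top of the prime-shift operator
compressed to the window, which lowers the infrared height of the zero-side certificates from
`exp(2S)` to `exp(L)`.  The tariff `splitTariff` and the sampling hypothesis `NearNullSamplingK` are
unchanged, so every existing certificate is consumed as is.  Nothing in this file bears on the truth
of RH: every positivity statement is conditional on `RHUpTo T₀` and on `NearNullSamplingK`.
-/

set_option linter.dupNamespace false

open scoped ContDiff ComplexConjugate Real Topology
open Complex MeasureTheory Set Filter Literature.NumberTheory.LFunctions
  Literature.Analysis.SpecialFunctions

namespace Summit.RiemannHypothesis.RiemannHypothesis.Theorems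
variable {g φ : ℝ → ℂ} {a δ : ℝ}

/-! ### The high part and THEOREM V with an abstract prime-term bound `L` -/

/-- **High part with margin, abstract prime bound.** If `‖prime(G₂)‖ ≤ L · M_φ(g)`,
`log π + L + c ≤ Re ψ(1/4 + ih/2)`, transparency `θ` holds on `|t| < |h|` and the polar defect is
`≤ p`, then `Re W(G₂) ≥ c · M_φ(g) - (W_h - W_0) θ ‖g‖₂² - 2 p e^a ‖g‖₁²`; no hypothesis on the
zeros (the proof of `weilFunctional_highPartK_re_ge` with `2 S(2a + δ)` replaced by `L`). -/
theorem weilFunctional_highPartK_re_ge_of_primeBound (hg : IsWeilTest g) (hsupp : tsupport g ⊆ Icc (-a) a)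
    (hφ : IsSplitKernel φ δ) {h c θ p L : ℝ} (hθ0 : 0 ≤ θ)
    (hθ : ∀ t : ℝ, |t| < |h| → 1 - lineSymbol φ t ≤ θ)
    (hp0 : ‖1 - weilMellin φ 0‖ ≤ p) (hp1 : ‖1 - weilMellin φ 1‖ ≤ p)
    (hpri : ‖weilPrimeTerm (highPartK g φ)‖ ≤ L * highMassK g φ)
    (hh : Real.log π + L + c ≤ reDigammaQuarter h) :
    c * highMassK g φ - (reDigammaQuarter h - reDigammaQuarter 0) * θ * weilNorm2Sq g
        - 2 * p * (Real.exp a * weilNorm1 g ^ 2) ≤ (weilFunctional (highPartK g φ)).re := by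
  set G := highPartK g φ with hG
  set M₂ := highMassK g φ with hM₂
  set W := reDigammaQuarter h
  set w₀ := reDigammaQuarter 0
  have hM₂0 : 0 ≤ M₂ := highMassK_nonneg hφ g
  have hπ : (0 : ℝ) < 2 * π := by positivity
  have hpol : -(2 * p * (Real.exp a * weilNorm1 g ^ 2)) ≤ (weilPolarTerm G).re := by
    have h1 := norm_weilPolarTerm_highPartK_le hg hsupp hφ hp0 hp1
    have h2 := neg_le_abs (weilPolarTerm G).re
    have h3 := Complex.abs_re_le_norm (weilPolarTerm G)
    linarith
  have hpri' : (weilPrimeTerm G).re ≤ L * M₂ := (Complex.re_le_norm _).trans hpri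
  have hstep := integral_mul_reDigammaQuarter_ge_step (fun t ↦ (highDensityK_bounds hφ g t).1)
    (integrable_highDensityK hg hφ) (integrable_highDensityK_mul_reDigammaQuarter hg hφ) h
  have hlow := setIntegral_highDensityK_le hg hφ hθ0 hθ
  have hWw : 0 ≤ W - w₀ := by linarith [reDigammaQuarter_zero_le h]
  have hint : ∫ t, highDensityK g φ t = 2 * π * M₂ := by
    rw [hM₂, highMassK, ← mul_assoc, mul_inv_cancel₀ hπ.ne', one_mul]
  have harchI : 2 * π * (W * M₂ - (W - w₀) * θ * weilNorm2Sq g) ≤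
      (weilArchIntegral G).re := by
    rw [weilArchIntegral_highPartK_re hg hφ]
    have : (W - w₀) * (∫ t in Ioo (-|h|) |h|, highDensityK g φ t) ≤
        (W - w₀) * (θ * (2 * π * weilNorm2Sq g)) :=
      mul_le_mul_of_nonneg_left hlow hWw
    rw [hint] at hstep
    linarith
  have hG0 : (G 0 * (Real.log π : ℂ)).re ≤ M₂ * Real.log π := by
    rw [Complex.re_mul_ofReal]
    refine mul_le_mul_of_nonneg_right ?_ (Real.log_nonneg (by linarith [Real.pi_gt_three]))
    exact (Complex.re_le_norm _).trans (norm_highPartK_le hg hφ 0)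
  have harch : W * M₂ - (W - w₀) * θ * weilNorm2Sq g - M₂ * Real.log π ≤
      (weilArchTerm G).re := by
    unfold weilArchTerm
    rw [Complex.sub_re]
    have e : ((1 / (2 * π) : ℂ) * weilArchIntegral G).re = 1 / (2 * π) * (weilArchIntegral G).re := by
      have : (1 / (2 * π) : ℂ) = ((1 / (2 * π) : ℝ) : ℂ) := by push_cast; ring
      rw [this, Complex.re_ofReal_mul]
    rw [e]
    have h3 : W * M₂ - (W - w₀) * θ * weilNorm2Sq g ≤ 1 / (2 * π) * (weilArchIntegral G).re := by
      rw [one_div, le_inv_mul_iff₀ hπ]; exact harchI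
    linarith
  have hW : weilFunctional G = weilPolarTerm G - weilPrimeTerm G + weilArchTerm G := rfl
  rw [hW, Complex.add_re, Complex.sub_re]
  have hkey : c * M₂ ≤ M₂ * (W - Real.log π - L) := by
    have : c ≤ W - Real.log π - L := by linarith
    nlinarith
  nlinarith [hpol, hpri', harch, hkey]

/-- **THEOREM V, abstract prime bound.** Under `RHUpTo T₀` (`T₀ ≥ 1`), `a > 0`, a split kernel `φ`
with transparency `θ` on `|t| < |h|`, polar defect `p`, strip decay `(D, k)`, the prime bound
`‖prime(G₂)‖ ≤ L · M_φ(g)` and the margin `log π + L + c ≤ Re ψ(1/4 + ih/2)`: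
`Re W(g ⋆ g̃) ≥ 𝒱_φ(g) + c · M_φ(g) - τ_φ ‖g‖₂²`. -/
theorem weilQuadratic_re_ge_verifiedGramK_of_primeBound (hg : IsWeilTest g) (ha : 0 < a)
    (hsupp : tsupport g ⊆ Icc (-a) a) (hφ : IsSplitKernel φ δ) {T₀ : ℝ} (hT₀ : 1 ≤ T₀)
    (hRH : RHUpTo T₀) {h c θ p D L : ℝ} {k : ℕ} (hθ0 : 0 ≤ θ)
    (hθ : ∀ t : ℝ, |t| < |h| → 1 - lineSymbol φ t ≤ θ) (hp : 0 ≤ p)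
    (hp0 : ‖1 - weilMellin φ 0‖ ≤ p) (hp1 : ‖1 - weilMellin φ 1‖ ≤ p)
    (hD : ∀ ρ : ℂ, 0 ≤ ρ.re → ρ.re ≤ 1 → ρ.im ≠ 0 → ‖weilMellin φ ρ‖ ≤ D ^ 2 / |ρ.im| ^ (2 * (k + 1)))
    (hpri : ‖weilPrimeTerm (highPartK g φ)‖ ≤ L * highMassK g φ)
    (hh : Real.log π + L + c ≤ reDigammaQuarter h) :
    verifiedGramK g φ T₀ + c * highMassK g φ - splitTariff a T₀ h θ p D k * weilNorm2Sq g ≤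
      (weilQuadratic g).re := by
  have hG₁ := isWeilTest_lowPartK hg hφ
  have hG₂ := isWeilTest_highPartK hg hφ
  have hsplit : weilQuadratic g =
      weilFunctional (lowPartK g φ) + weilFunctional (highPartK g φ) := by
    rw [← weilFunctional_add hG₁ hG₂, lowPartK_add_highPartK]; rfl
  have h1 := weilFunctional_lowPartK_re_ge hg ha.le hsupp hφ hD hT₀ hRH
  have h2 := weilFunctional_highPartK_re_ge_of_primeBound hg hsupp hφ hθ0 hθ hp0 hp1 hpri hh
  have hX := weilNorm1_sq_le hg ha hsupp
  have hT₀pos : 0 < T₀ := by linarith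
  have hA₁ := zetaDensityConst_pos
  have hl2 : 0 ≤ Real.log 2 := Real.log_nonneg (by norm_num)
  have hc₁ : 0 ≤ 4 * Real.log 2 * zetaDensityConst * Real.exp a * D ^ 2 := by positivity
  have hlow : lowErrK g a T₀ D k ≤
      8 * Real.log 2 * zetaDensityConst * a * Real.exp a * D ^ 2 / T₀ ^ (2 * k) * weilNorm2Sq g := by
    have := mul_le_mul_of_nonneg_left hX hc₁
    calc lowErrK g a T₀ D k
        = 4 * Real.log 2 * zetaDensityConst * Real.exp a * D ^ 2 * weilNorm1 g ^ 2 /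
            T₀ ^ (2 * k) := by rw [lowErrK]; ring
      _ ≤ 4 * Real.log 2 * zetaDensityConst * Real.exp a * D ^ 2 * (2 * a * weilNorm2Sq g) /
            T₀ ^ (2 * k) := div_le_div_of_nonneg_right this (by positivity)
      _ = _ := by ring
  have hpol : 2 * p * (Real.exp a * weilNorm1 g ^ 2) ≤ 4 * p * a * Real.exp a * weilNorm2Sq g := by
    have hc : 0 ≤ 2 * p * Real.exp a := by positivity
    have := mul_le_mul_of_nonneg_left hX hc
    nlinarith
  rw [hsplit, Complex.add_re]
  unfold splitTariff
  nlinarith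

/-- **The reduction, abstract prime bound.** `RHUpTo T₀`, a split kernel with the parameters
`θ, p, D, k`, a prime bound `‖prime(G₂)‖ ≤ L · M_φ(g)` valid for every window test, the margin
`log π + L + c ≤ Re ψ(1/4 + ih/2)` and `NearNullSamplingK` give Weil positivity on `[-a, a]`. -/
theorem weilPositivityOn_of_rhUpTo_of_nearNullSamplingK_of_primeBound (ha : 0 < a)
    (hφ : IsSplitKernel φ δ) {T₀ : ℝ} (hT₀ : 1 ≤ T₀) (hRH : RHUpTo T₀) {h c θ p D L : ℝ} {k : ℕ}
    (hθ0 : 0 ≤ θ) (hθ : ∀ t : ℝ, |t| < |h| → 1 - lineSymbol φ t ≤ θ) (hp : 0 ≤ p)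
    (hp0 : ‖1 - weilMellin φ 0‖ ≤ p) (hp1 : ‖1 - weilMellin φ 1‖ ≤ p)
    (hD : ∀ ρ : ℂ, 0 ≤ ρ.re → ρ.re ≤ 1 → ρ.im ≠ 0 → ‖weilMellin φ ρ‖ ≤ D ^ 2 / |ρ.im| ^ (2 * (k + 1)))
    (hpri : ∀ g : ℝ → ℂ, IsWeilTest g → tsupport g ⊆ Icc (-a) a →
      ‖weilPrimeTerm (highPartK g φ)‖ ≤ L * highMassK g φ)
    (hh : Real.log π + L + c ≤ reDigammaQuarter h)
    (hNNS : NearNullSamplingK a φ T₀ h c θ p D k) : WeilPositivityOn a := by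
  intro g hg hsupp
  have h1 := weilQuadratic_re_ge_verifiedGramK_of_primeBound hg ha hsupp hφ hT₀ hRH hθ0 hθ hp hp0
    hp1 hD (hpri g hg hsupp) hh
  have h2 := hNNS g hg hsupp
  linarith

/-- The tree's prime bound is the case `L = 2 S(2a + δ)`. -/
theorem norm_weilPrimeTerm_highPartK_le_two_primeSum (hg : IsWeilTest g)
    (hsupp : tsupport g ⊆ Icc (-a) a) (hφ : IsSplitKernel φ δ) :
    ‖weilPrimeTerm (highPartK g φ)‖ ≤ (2 * primeSum (2 * a + δ)) * highMassK g φ := by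
  have := norm_weilPrimeTerm_highPartK_le hg hsupp hφ
  linarith

end Summit.RiemannHypothesis.RiemannHypothesis.Theorems
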